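import Summits.AnomalousDissipation.AnomalousDissipation.Theorems.ImpulseGridKickLemmaTools
import Summits.AnomalousDissipation.AnomalousDissipation.Theses.ImpulseGrid

/-!
# AnomalousDissipation / ImpulseGrid — support item `KickLemma`

Route `AnomalousDissipation/ImpulseGrid`, item stmt-AnomalousDissipation-1775 (`KickLemma`, support,
rank 9; NOT in the assembly): the time-domain twin of the route's mechanism. For a smooth
divergence-free kick pattern `g` on `T³`, a `T`-periodic kick train `f(t,x) = φ(t mod T) g(x)`
(`φ ≥ 0` smooth, supported in `(0, δ)`, `∫₀^δ φ = 1`, `δ < T`) and a global Leray–Hopf solution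
`u` with `½‖u(t)‖₂² ≤ E` for `t ≥ 0`, the work of kick number `n ≥ 1`,
`W_n = ∫_{nT}^{nT+δ} φ(t − nT) (g, u(t)) dt`, satisfies
`|W_n − ½‖g‖₂² − (g, u(nT))| ≤ K (1 + E) δ` with `K = K(g)` independent of `ν ≤ 1, T, δ, E`.

Proof (deterministic twin of the random-kick energy balance, Kuksin–Shirikyan 2012 §2): with
`a = nT`, `Φ(τ) = ∫₀^τ φ` and the smooth compactly supported time test
`η(s) = χ(s) (1 − Φ(s − a))` (`χ` a smooth cutoff equal to `1` on `[0, ∞)`), the space–time weak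
formulation tested with `η(s) g(x)` (`Torus.IsWeakNSSolutionForcedOn.test_smul`) reads
`∫ φ(s−a)(u(s),g) ds = (u₀,g) + ∫ (1 − Φ(s−a)) F(s) ds`,
`F(s) = (u,(u·∇)g) + ν(u,Δg) + (f(s),g)`; the time-sliced identity at `t = a`
(`Torus.IsLerayHopfOn.integral_inner_eq_add_setIntegral`) turns `(u₀,g) + ∫_{(0,a]} F` into
`(u(a),g)`; on `(a, a+δ)` the force term contributes `‖g‖₂² ∫₀^δ (1−Φ)φ = ½‖g‖₂²` exactly, and the
remainder `∫_{(a,a+δ)} (1−Φ(s−a)) [(u,(u·∇)g) + ν(u,Δg)] ds` is at most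
`δ · (2D + K_L)(1 + E)` where `∑ᵢ‖∂ᵢg‖ ≤ D`, `‖Δg‖ ≤ K_L` pointwise.

No Fubini and no integration by parts of merely absolutely continuous functions is needed: the
time test `η` does the integration by parts inside the weak formulation. The real-variable
helpers (primitive of the profile, free half-kick `∫₀^δ(1−Φ)φ = ½`, kick-train measurability,
slice bound, one-kick bookkeeping) live in `ImpulseGridKickLemmaTools.lean`.
-/

noncomputable section

-- `Summit.<Summit>.<Problem>` is the tree's mandated summit-side namespace (CONVENTIONS §2); for this
-- single-conjunct summit the two coincide, so the duplicate is deliberate.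
set_option linter.dupNamespace false

open MeasureTheory TopologicalSpace Set Function Filter Topology
open scoped InnerProductSpace RealInnerProductSpace ENNReal NNReal ContDiff

namespace Summit.AnomalousDissipation.AnomalousDissipation.Theorems

open Literature.Analysis Literature.Analysis.FluidPDE Literature.Analysis.FunctionSpaces
open Summit.AnomalousDissipation.AnomalousDissipation.Theses.ImpulseGrid

/-! ### The kick lemma -/

/-- **KickLemma** (settles stmt-AnomalousDissipation-1775, support item of route ImpulseGrid). For
a smooth divergence-free `g` there is `K = 2D + K_L` (`∑ᵢ‖∂ᵢg‖ ≤ D`, `‖Δg‖ ≤ K_L`) such that for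
every `0 < ν ≤ 1`, `0 < δ < T`, smooth `φ ≥ 0` supported in `(0, δ)` with `∫₀^δ φ = 1`, every
global Leray–Hopf solution `u` of the kick-train-forced system `f = φ(T·fract(t/T)) g` with
`½‖u(t)‖² ≤ E` (`t ≥ 0`) and every `n ≥ 1`:
`|∫_{nT}^{nT+δ} φ(t−nT)(g,u(t)) dt − ½‖g‖₂² − (g,u(nT))| ≤ K (1+E) δ`.
Deterministic twin of the random-kick energy balance (Kuksin–Shirikyan 2012, §2). [folklore] -/
theorem kickLemma_proof : KickLemma := by
  unfold KickLemma
  intro g hg hgdiv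
  obtain ⟨D, hD0, hD⟩ := Torus.exists_sum_norm_partialDeriv_le hg
  obtain ⟨KL, hKL0, hKL⟩ :=
    Torus.exists_nonneg_forall_norm_le_of_continuous hg.laplacian.continuous
  refine ⟨2 * D + KL, ?_⟩
  intro ν T δ E φ u₀ u n hν hν1 hδ hδT hφ hsupp hφnn hφint hLH hEn hn
  have hT : 0 < T := hδ.trans hδT
  have hn1 : (1:ℝ) ≤ n := by exact_mod_cast hn
  set a : ℝ := (n:ℝ) * T with ha_def
  have ha : 0 < a := mul_pos (by linarith) hT
  have haT₁ : a + δ < a + T := by linarith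
  have hT₁ : 0 < a + T := by linarith
  set f : ℝ → UnitAddTorus (Fin 3) → EuclideanSpace ℝ (Fin 3) :=
    fun t x => φ (T * Int.fract (t / T)) • g x with hf_def
  have hu : Torus.IsLerayHopfOn (a + T) ν f u₀ u := hLH (a + T) hT₁
  have hφc : Continuous φ := hφ.continuous
  have hfm : AEStronglyMeasurable (Torus.stLift f) (volume.restrict (Ioo 0 (a + T) ×ˢ univ)) :=
    aestronglyMeasurable_stLift_kickTrain hφc T hg _
  have hf₂ : ∫⁻ t in Ioo 0 (a + T), ∫⁻ x, ‖f t x‖ₑ ^ 2 < ⊤ :=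
    lintegral_kickTrain_lt_top hφc hsupp T (a + T) hg
  -- the kick is `φ(s − a) g` on the `n`-th period
  have hfs : ∀ s ∈ Ioo a (a + δ), f s = fun x => φ (s - a) • g x := by
    intro s hs
    have h := kickTrain_mul_fract_div_eq_sub (s := s) (n := n) hT hs.1.le (by rw [add_mul, one_mul]; linarith [hs.2])
    simp only [hf_def, h, ha_def]
  have hfI : ∀ s, Integrable (f s) volume := fun s => by
    rw [hf_def]
    exact hg.integrable.fun_smul _
  -- energy bound, honest form
  have hE0 : 0 ≤ E := (Torus.kineticEnergy_nonneg (u 0)).trans (hEn 0 le_rfl)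
  -- the primitive of the profile and the time test
  obtain ⟨Φ, hΦ_def⟩ : ∃ Φ : ℝ → ℝ, Φ = fun τ => ∫ s in (0:ℝ)..τ, φ s := ⟨_, rfl⟩
  have hΦd : ∀ τ, HasDerivAt Φ (φ τ) τ := hΦ_def ▸ kick_prim_hasDerivAt hφc
  have hΦs : ContDiff ℝ ∞ Φ := hΦ_def ▸ kick_prim_contDiff hφ
  have hΦc : Continuous Φ := hΦs.continuous
  have hΦ0 : ∀ τ, τ ≤ 0 → Φ τ = 0 := fun τ hτ => by
    rw [hΦ_def]; exact kick_prim_eq_zero hsupp hτ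
  have hΦ1 : ∀ τ, δ ≤ τ → Φ τ = 1 := fun τ hτ => by
    rw [hΦ_def]; exact kick_prim_eq_one hφc hsupp hφint hτ
  have hΦnn : ∀ τ, 0 ≤ Φ τ := fun τ => by
    rw [hΦ_def]; exact kick_prim_nonneg hsupp hφnn τ
  have hΦle : ∀ τ, Φ τ ≤ 1 := fun τ => by
    rw [hΦ_def]; exact kick_prim_le_one hφc hsupp hφnn hφint τ
  have hhalf : ∫ τ in (0:ℝ)..δ, (1 - Φ τ) * φ τ = 2⁻¹ :=
    kick_integral_one_sub_prim_mul hφc hΦd (hΦ0 0 le_rfl) (hΦ1 δ le_rfl)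
  set χ : ℝ → ℝ := fun s => Real.smoothTransition (s + 1) with hχ_def
  have hχs : ContDiff ℝ ∞ χ :=
    Real.smoothTransition.contDiff.comp (contDiff_id.add contDiff_const)
  have hχ1 : ∀ s, 0 ≤ s → χ s = 1 := fun s hs =>
    Real.smoothTransition.one_of_one_le (by linarith)
  have hχ0 : ∀ s, s ≤ -1 → χ s = 0 := fun s hs =>
    Real.smoothTransition.zero_of_nonpos (by linarith)
  set η : ℝ → ℝ := fun s => χ s * (1 - Φ (s - a)) with hη_def
  have hηs : ContDiff ℝ ∞ η :=
    hχs.mul (contDiff_const.sub (hΦs.comp (contDiff_id.sub contDiff_const)))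
  have hη_eq : ∀ s, 0 ≤ s → η s = 1 - Φ (s - a) := fun s hs => by
    simp only [hη_def, hχ1 s hs, one_mul]
  have hη0 : η 0 = 1 := by
    rw [hη_eq 0 le_rfl, zero_sub, hΦ0 _ (by linarith), sub_zero]
  have hη_zero : ∀ s, s ∉ Icc (-1) (a + δ) → η s = 0 := by
    intro s hs
    rw [mem_Icc, not_and_or, not_le, not_le] at hs
    rcases hs with hs | hs
    · simp only [hη_def, hχ0 s hs.le, zero_mul]
    · simp only [hη_def, hΦ1 (s - a) (by linarith), sub_self, mul_zero]
  have hηc : HasCompactSupport η := HasCompactSupport.intro isCompact_Icc hη_zero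
  have hηT : tsupport η ⊆ Iio (a + T) := by
    intro s hs
    have h' : s ∈ Icc (-1) (a + δ) :=
      closure_minimal (support_subset_iff'.2 hη_zero) isClosed_Icc hs
    exact lt_of_le_of_lt h'.2 haT₁
  have hηderiv : ∀ s, 0 < s → deriv η s = -φ (s - a) := by
    intro s hs
    have h1 : HasDerivAt (fun s => 1 - Φ (s - a)) (-φ (s - a)) s :=
      (HasDerivAt.comp_sub_const s a (hΦd (s - a))).const_sub 1
    have h2 : η =ᶠ[𝓝 s] fun s => 1 - Φ (s - a) :=
      Filter.eventuallyEq_of_mem (Ioi_mem_nhds hs) fun s' hs' => hη_eq s' (le_of_lt hs')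
    exact (h1.congr_of_eventuallyEq h2).deriv
  -- the tested weak formulation and the time-sliced identity
  have hfL1 : ∀ᵐ s ∂(volume.restrict (Ioo 0 (a + T))), Integrable (f s) volume :=
    ae_of_all _ fun s => hfI s
  have htest := hu.weak.test_smul (fun s hs => hu.memLp s (Ioo_subset_Icc_self hs)) hfL1 hg
    hgdiv hηs hηc hηT
  have hcongr : (∫ s in Ioo 0 (a + T), ((deriv η s * ∫ x, ⟪u s x, g x⟫) +
      η s * ∫ x, (⟪u s x, Torus.convect (u s) g x⟫ + ν * ⟪u s x, Torus.laplacian g x⟫ +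
        ⟪f s x, g x⟫))) =
      ∫ s in Ioo 0 (a + T), ((-φ (s - a) * ∫ x, ⟪u s x, g x⟫) +
      (1 - Φ (s - a)) * ∫ x, (⟪u s x, Torus.convect (u s) g x⟫ +
        ν * ⟪u s x, Torus.laplacian g x⟫ + ⟪f s x, g x⟫)) :=
    setIntegral_congr_fun measurableSet_Ioo fun s hs => by
      rw [hηderiv s hs.1, hη_eq s hs.1.le]
  rw [hcongr, hη0, one_mul] at htest
  have hslice := hu.integral_inner_eq_add_setIntegral hT₁ hfm hf₂ hg hgdiv ⟨ha, by linarith⟩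
  -- the core bound on `(a, a + δ)`
  have hcore : ∀ s ∈ Ioo a (a + δ),
      |(∫ x, (⟪u s x, Torus.convect (u s) g x⟫ + ν * ⟪u s x, Torus.laplacian g x⟫ +
        ⟪f s x, g x⟫)) - φ (s - a) * ∫ x, ‖g x‖ ^ 2| ≤ (2 * D + KL) * (1 + E) := by
    intro s hs
    have hs0 : 0 ≤ s := by linarith [hs.1]
    have hmem : MemLp (u s) 2 volume := hu.memLp s ⟨hs0, by linarith [hs.2]⟩
    have i1 := Torus.integrable_inner_convect_self hmem hg
    have i2 : Integrable (fun x => ⟪u s x, Torus.laplacian g x⟫) volume :=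
      Torus.integrable_inner_of_continuous (hmem.integrable one_le_two) hg.laplacian.continuous
    have i3 : Integrable (fun x => ⟪f s x, g x⟫) volume :=
      Torus.integrable_inner_of_continuous (hfI s) hg.continuous
    have hforce : ∫ x, ⟪f s x, g x⟫ = φ (s - a) * ∫ x, ‖g x‖ ^ 2 := by
      rw [hfs s hs, ← integral_const_mul]
      refine integral_congr_ae (ae_of_all _ fun x => ?_)
      simp only [real_inner_smul_left, real_inner_self_eq_norm_sq]
    have i12 : Integrable (fun x => ⟪u s x, Torus.convect (u s) g x⟫ +
        ν * ⟪u s x, Torus.laplacian g x⟫) volume := i1.add (i2.const_mul ν)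
    rw [integral_add i12 i3, integral_add i1 (i2.const_mul ν),
      integral_const_mul, hforce, add_sub_cancel_right]
    exact kick_abs_flux_core_le hmem hg hD hKL0 hKL hν hν1 (hEn s hs0)
  have key := kick_bookkeeping (U := fun s => ∫ x, ⟪u s x, g x⟫)
    (F := fun s => ∫ x, (⟪u s x, Torus.convect (u s) g x⟫ +
      ν * ⟪u s x, Torus.laplacian g x⟫ + ⟪f s x, g x⟫))
    ha hδ haT₁ hφc hΦc hsupp hΦ0 hΦ1 hΦnn hΦle hhalf (hu.integrableOn_integral_inner hg.continuous)
    (hu.integrableOn_flux hfm hf₂ hg) htest hslice hcore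
  have hcomm : ∀ v : UnitAddTorus (Fin 3) → EuclideanSpace ℝ (Fin 3),
      (∫ x, ⟪g x, v x⟫) = ∫ x, ⟪v x, g x⟫ := fun v =>
    integral_congr_ae (ae_of_all _ fun x => real_inner_comm _ _)
  simp_rw [hcomm]
  exact key

end Summit.AnomalousDissipation.AnomalousDissipation.Theorems

end
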